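/-
Copyright (c) 2026 the pub-hodgecm-mathlib formalisation cell (harness21).  Prover seat hodgecm-mathlib-R90-C131-p02 (g2) on the S4 valve (dealer K2E2-plan (g8), S4-R59 (4) ∕
S4-R63), road (J̃♭) FILE (TJ6) «HERBRAND WINDOW», part 2a of 3: THE VELOCITY LAW OF THE CAYLEY CHART ON A COMMUTATIVE WINDOW AND ITS EIGEN-LATTICES.
Crux H413 `stmt-HodgeConjecture-24833`, lane `--supports … --as helper` (count-neutral).  THEOREMS ONLY (no `def`, no `instance`, no notation, no named-fact hypothesis, no `sorry`).
-/
import Literature.NumberTheory.Weil1982.CayleyWindowCentralizerData                    -- ★ `nonsing_inv_comm_of_comm`, `valBound_smul` (brings ★ (C2) `CayleyProductSandwich`: `cayley_mul_cayley_eq_cayley`, `isUnit_det_one_{sub,add,add_mul}_of_valBound`)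
import HarnessLib

/-!
# R90-TF · S4 (Ch. 13.1–2) · road (J̃♭) «TWISTED TUBE JACOBIAN», FILE (TJ6) «HERBRAND WINDOW», part 2a: THE VELOCITY LAW AND THE EIGEN-LATTICES

Cell `hodgecm-mathlib`, crux H413 (`stmt-HodgeConjecture-24833`, lane `--supports … --as helper`), route of record `HCCMUnconditional` (no route verbs;
count-neutral).  Programme R90-TF, section S4 = [Rogawski1990] Ch. 13.1–13.2 (twisted Weyl integration formula, §12.5 p. 186); seat R90-C131-p02 (g2);
ORDER = S4 dealer K2E2-plan (g8) S4-R59 (4) «(TJ6) HERBRAND WINDOW», spec S4-R63 (K2E3-p03 (g10)'s `h♮`).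

SETTING.  `K` a field with a valuation (`ValuativeRel`; a non-archimedean local field where topology is used), `α < 1` the level ratio, `𝔞 ⊆ M_m(K)`
a COMMUTATIVE `K`-subalgebra closed under inverses (at the datum: `𝔞 = Cent_{M₃(L_w)}(γ₀)`, `γ₀` regular), `E` an additive ANTI-involution of `M_m(K)`
(`E(XY) = E Y · E X`, `E 1 = 1`; at the datum `E X = Φ⁻¹ σ(X)ᵀ Φ`, the slot map of the twist `ε`), a parity `s` with `s·s = 1`, and the EIGEN-LATTICES
`M i = {X | X ≤ α^(i+1), X ∈ 𝔞, E X = s • X}` (a membership LETTER `hM`, no definition).  On the commutative `𝔞` the Cayley map `c(X) = (1 + X)(1 − X)⁻¹` turns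
the group law into `c(W)·c(Z) = c(S(W, Z))`, `S(W, Z) = (W + Z)(1 + WZ)⁻¹` («velocity addition»), so squaring is `c(W)² = c(2ψ(W))`, `ψ(W) = W(1 + W²)⁻¹`.

THE RESULTS (all PROVED; pure algebra, no topology).
* §1 `cayley_mul_cayley_of_comm` (the law `S`), `valBound_velocity_add`, `cayley_mul_self_eq` (`c(W)² = c(ψW + ψW)`); the two COSET IDENTITIES
  `velocity_add_double_eq` (`S(W, a+a) = W + (a′+a′)`, `a′ = a(1 − W²)(1 + W(a+a))⁻¹`) and `add_double_eq_velocity` (`W + (a+a) = S(W, a″+a″)`,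
  `a″ = a(1 − (W² + (a+a)W))⁻¹`) — so the `S`-cosets and the `+`-cosets of `2M` through `W` COINCIDE.
* §2 `E`-calculus and closure of the eigen-lattices: `map_nonsing_inv_eq` (`E X⁻¹ = (E X)⁻¹`), `map_one_add_mul_eq`, `mul_even_mem`, `valBound_of_mem`,
  `velocity_add_mem`, `psi_mem`, `coset_corr_mem`, `coset_corr_mem'` (`S(W,Z)`, `ψ W`, `a′`, `a″` stay in `M i`).
Parts 2b (`R90S4CayleyPsiNewton`: `ψ(M i) = M i`) and 2c (`R90S4CayleyWindowDoubling`: `[c(M i) : c(M i)²] = [M i : 2M i] ≠ 0`, `θ`-transport) follow.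

HONEST LABEL: HC_CM is proved only modulo the 7 printed citations (2 remaining named inputs: hLiu418 = `stmt-HodgeConjecture-24832`, h413 =
`stmt-HodgeConjecture-24833`) until rung 0 closes; this file closes no socket (REL ≠ ★ ≠ BUILT; count-neutral).

## References
* [Serre1992LALG] J.-P. Serre, *Lie Algebras and Lie Groups*, LNM 1500 (1992), Part II Ch. IV §8–§9 (standard groups, filtrations, the Cayley ∕ exponential charts). Context locator.
* [Serre1979] J.-P. Serre, *Local Fields*, GTM 67 (1979), VIII §4 (Herbrand quotient). Context locator.
* [PlatonovRapinchuk1994] V. Platonov, A. Rapinchuk, *Algebraic Groups and Number Theory* (1994), §3.3 (congruence subgroups, Cayley map). Context locator.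
* [Rogawski1990] J. D. Rogawski, *Automorphic Representations of Unitary Groups in Three Variables*, Ann. of Math. Stud. 123 (1990), §12.5 p. 186. Context locator.
-/

set_option autoImplicit false
-- the mandated namespace repeats the single-problem summit's segment (`HodgeConjecture.HodgeConjecture`)
set_option linter.dupNamespace false

open Matrix ValuativeRel
open Literature.NumberTheory.Automorphic Literature.NumberTheory.Weil1982.UnitaryFinTopForm
open scoped Matrix MatrixGroups

namespace Summit.HodgeConjecture.HodgeConjecture.R90.S4

/-! ## §1 The velocity-addition law on a commutative window and the two coset identities -/

section Algebra

variable {K : Type*} [Field K] [ValuativeRel K] {m : Type*} [Fintype m] [DecidableEq m]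

/-- On COMMUTING small matrices the Cayley product collapses: `c(W)·c(Z) = c((W + Z)(1 + WZ)⁻¹)` (★ `cayley_mul_cayley_eq_cayley`: the sandwich
`(1 − W)⁻¹ (W + Z)(1 + WZ)⁻¹ (1 − W)` commutes past `1 − W`). [cite: Serre1992LALG, Part II Ch. IV §8] [cite: PlatonovRapinchuk1994, §3.3] -/
theorem cayley_mul_cayley_of_comm {α β : ValueGroupWithZero K} {W Z : Matrix m m K} (hW : ValBound α W) (hZ : ValBound β Z) (hα : α < 1) (hβ : β < 1)
    (hc : W * Z = Z * W) : cayley W * cayley Z = cayley ((W + Z) * (1 + W * Z)⁻¹) := by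
  obtain ⟨hWu, -, -⟩ := isUnit_det_one_sub_of_valBound hW hα
  obtain ⟨hZu, -, -⟩ := isUnit_det_one_sub_of_valBound hZ hβ
  obtain ⟨hB, -, -⟩ := isUnit_det_one_add_mul_of_valBound hW hZ hα hβ.le
  rw [cayley_mul_cayley_eq_cayley hWu hZu hB]
  congr 1
  have hA : (W + Z) * (1 - W) = (1 - W) * (W + Z) := by
    rw [add_mul, mul_add, mul_sub, sub_mul, mul_one, one_mul, mul_sub, sub_mul, mul_one, one_mul, hc]
  have hB0 : (1 + W * Z) * (1 - W) = (1 - W) * (1 + W * Z) := by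
    rw [add_mul, mul_add, one_mul, mul_one, mul_sub, sub_mul, mul_one, one_mul, mul_assoc, ← hc, ← mul_assoc]
  have hBi : (1 + W * Z)⁻¹ * (1 - W) = (1 - W) * (1 + W * Z)⁻¹ := nonsing_inv_comm_of_comm hB hB0
  calc (1 - W)⁻¹ * (W + Z) * (1 + W * Z)⁻¹ * (1 - W) = (1 - W)⁻¹ * ((W + Z) * ((1 + W * Z)⁻¹ * (1 - W))) := by simp only [mul_assoc]
    _ = (1 - W)⁻¹ * ((1 - W) * ((W + Z) * (1 + W * Z)⁻¹)) := by rw [hBi, ← mul_assoc (W + Z), hA, mul_assoc]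
    _ = (W + Z) * (1 + W * Z)⁻¹ := by rw [← mul_assoc, Matrix.nonsing_inv_mul _ hWu, one_mul]

/-- The velocity sum of small commuting matrices is small: `(W + Z)(1 + WZ)⁻¹ ≤ max(|W|, |Z|)` entrywise (`(1 + WZ)⁻¹` is integral, ★ (C2)).
[cite: Serre1992LALG, Part II Ch. IV §8] -/
theorem valBound_velocity_add {α β : ValueGroupWithZero K} {W Z : Matrix m m K} (hW : ValBound α W) (hZ : ValBound β Z) (hα : α < 1) (hβ : β ≤ 1) :
    ValBound (max α β) ((W + Z) * (1 + W * Z)⁻¹) := by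
  obtain ⟨-, hBi, -⟩ := isUnit_det_one_add_mul_of_valBound hW hZ hα hβ
  have hWZ : ValBound (max α β) (W + Z) := (hW.mono (le_max_left _ _)).add (hZ.mono (le_max_right _ _))
  simpa using hWZ.mul hBi

/-- **SQUARING IN THE CHART**: for a small `W`, `c(W)·c(W) = c(ψ W + ψ W)` with `ψ W = W(1 + W·W)⁻¹` (velocity addition `S(W, W) = 2ψ(W)`).
[cite: Serre1992LALG, Part II Ch. IV §8] [cite: PlatonovRapinchuk1994, §3.3] -/
theorem cayley_mul_self_eq {α : ValueGroupWithZero K} {W : Matrix m m K} (hW : ValBound α W) (hα : α < 1) :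
    cayley W * cayley W = cayley (W * (1 + W * W)⁻¹ + W * (1 + W * W)⁻¹) := by
  rw [cayley_mul_cayley_of_comm hW hW hα hα rfl, add_mul]

/-- **COSET IDENTITY (1)**: `S(W, a + a) = W + (a′ + a′)` with `a′ = a(1 − W²)(1 + W(a + a))⁻¹`, for commuting `W, a` with `W` small and `a` integral-small
(all inverses exist by ★ (C2)).  [cite: Serre1992LALG, Part II Ch. IV §8] -/
theorem velocity_add_double_eq {α : ValueGroupWithZero K} {W a : Matrix m m K} (hW : ValBound α W) (ha : ValBound α a) (hα : α < 1) (hc : W * a = a * W) :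
    (W + (a + a)) * (1 + W * (a + a))⁻¹ =
      W + (a * (1 - W * W) * (1 + W * (a + a))⁻¹ + a * (1 - W * W) * (1 + W * (a + a))⁻¹) := by
  have haa : ValBound α (a + a) := ha.add ha
  obtain ⟨hB, -, -⟩ := isUnit_det_one_add_mul_of_valBound hW haa hα hα.le
  set B : Matrix m m K := 1 + W * (a + a) with hBdef
  have hc2 : W * (a + a) = (a + a) * W := by rw [mul_add, add_mul, hc]
  -- `(W + (a′ + a′)) · B = W + (a + a)`
  have hkey : (W + (a * (1 - W * W) * B⁻¹ + a * (1 - W * W) * B⁻¹)) * B = W + (a + a) := by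
    have h1 : a * (1 - W * W) * B⁻¹ * B = a * (1 - W * W) := Matrix.nonsing_inv_mul_cancel_right _ _ hB
    rw [add_mul W, add_mul (a * (1 - W * W) * B⁻¹), h1, hBdef]
    have h : W * (1 + W * (a + a)) + (a * (1 - W * W) + a * (1 - W * W)) - (W + (a + a)) = W * (W * (a + a)) - (a + a) * (W * W) := by
      noncomm_ring
    have h' : W * (W * (a + a)) = (a + a) * (W * W) := by rw [hc2, ← mul_assoc, hc2, mul_assoc]
    rw [h', sub_self] at h
    exact sub_eq_zero.1 h
  calc (W + (a + a)) * B⁻¹ = (W + (a * (1 - W * W) * B⁻¹ + a * (1 - W * W) * B⁻¹)) * B * B⁻¹ := by rw [hkey]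
    _ = _ := Matrix.mul_nonsing_inv_cancel_right _ _ hB

/-- **COSET IDENTITY (2)**: `W + (a + a) = S(W, a″ + a″)` with `a″ = a(1 − (W² + (a + a)W))⁻¹`, for commuting `W, a`, both small.
[cite: Serre1992LALG, Part II Ch. IV §8] -/
theorem add_double_eq_velocity {α : ValueGroupWithZero K} {W a : Matrix m m K} (hW : ValBound α W) (ha : ValBound α a) (hα : α < 1) (hc : W * a = a * W) :
    W + (a + a) =
      (W + (a * (1 - (W * W + (a + a) * W))⁻¹ + a * (1 - (W * W + (a + a) * W))⁻¹)) *
        (1 + W * (a * (1 - (W * W + (a + a) * W))⁻¹ + a * (1 - (W * W + (a + a) * W))⁻¹))⁻¹ := by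
  have haa : ValBound α (a + a) := ha.add ha
  have hsmall : ValBound α (W * W + (a + a) * W) := by
    have h1 : ValBound (α * α) (W * W) := hW.mul hW
    have h2 : ValBound (α * α) ((a + a) * W) := haa.mul hW
    exact (h1.add h2).mono (by simpa using mul_le_mul' le_rfl hα.le)
  obtain ⟨hD, hDi1, -⟩ := isUnit_det_one_sub_of_valBound hsmall hα
  set D : Matrix m m K := 1 - (W * W + (a + a) * W) with hDdef
  -- `a` commutes with `D`
  have haD : D * a = a * D := by
    have h1 : W * W * a = a * (W * W) := by rw [mul_assoc, hc, ← mul_assoc, hc, mul_assoc]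
    have h2 : (a + a) * W * a = a * ((a + a) * W) := by rw [mul_assoc, hc, ← mul_assoc, ← mul_assoc, add_mul, mul_add]
    rw [hDdef, sub_mul, mul_sub, one_mul, mul_one, add_mul, mul_add, h1, h2]
  set Y : Matrix m m K := a * D⁻¹ + a * D⁻¹ with hYdef
  have hYsmall : ValBound α Y := by
    have h := ha.mul hDi1
    rw [mul_one] at h
    exact h.add h
  obtain ⟨hBY, -, -⟩ := isUnit_det_one_add_mul_of_valBound hW hYsmall hα hα.le
  -- `D · Y = a + a`
  have hDY : D * Y = a + a := by
    rw [hYdef, mul_add, ← mul_assoc, haD, mul_assoc, Matrix.mul_nonsing_inv _ hD, mul_one]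
  -- `(W + (a + a)) · (1 + W Y) = W + Y`
  have hkey : (W + (a + a)) * (1 + W * Y) = W + Y := by
    have hsplit : (W + (a + a)) * (1 + W * Y) = W + (a + a) + (W * W + (a + a) * W) * Y := by noncomm_ring
    have hWD : W * W + (a + a) * W = 1 - D := by rw [hDdef, sub_sub_cancel]
    rw [hsplit, hWD, sub_mul, one_mul, hDY]
    abel
  calc W + (a + a) = (W + (a + a)) * (1 + W * Y) * (1 + W * Y)⁻¹ := (Matrix.mul_nonsing_inv_cancel_right _ _ hBY).symm
    _ = (W + Y) * (1 + W * Y)⁻¹ := by rw [hkey]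

end Algebra

/-! ## §2 The eigen-lattices `M i = {X ≤ α^(i+1)} ∩ 𝔞 ∩ {E X = s•X}`: closure under the operations of §1 -/

section Eigen

variable {K : Type*} [Field K] [ValuativeRel K] {m : Type*} [Fintype m] [DecidableEq m]
  (𝔞 : Subalgebra K (Matrix m m K)) (h𝔞c : ∀ X ∈ 𝔞, ∀ Y ∈ 𝔞, X * Y = Y * X) (h𝔞i : ∀ X ∈ 𝔞, IsUnit X.det → X⁻¹ ∈ 𝔞)
  (E : Matrix m m K →+ Matrix m m K) (hEm : ∀ X Y, E (X * Y) = E Y * E X) (hE1 : E 1 = 1)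
  {s : K} (hs : s * s = 1) {α : ValueGroupWithZero K}
  (M : ℕ → AddSubgroup (Matrix m m K)) (hM : ∀ i X, X ∈ M i ↔ (ValBound (α ^ (i + 1)) X ∧ X ∈ 𝔞 ∧ E X = s • X))

omit [ValuativeRel K] in
include hEm hE1 in
/-- An anti-multiplicative unital additive `E` inverts inverses: `E (X⁻¹) = (E X)⁻¹` for invertible `X`. [cite: Serre1992LALG, Part II Ch. IV §8] -/
theorem map_nonsing_inv_eq {X : Matrix m m K} (hX : IsUnit X.det) : E X⁻¹ = (E X)⁻¹ := by
  symm
  apply Matrix.inv_eq_left_inv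
  rw [← hEm, Matrix.mul_nonsing_inv _ hX, hE1]

omit [ValuativeRel K] in
include hEm hE1 hs in
/-- `1 + W·Z` is `E`-EVEN when `W`, `Z` have the same parity `s` and commute. [cite: Serre1992LALG, Part II Ch. IV §8] -/
theorem map_one_add_mul_eq {W Z : Matrix m m K} (hW : E W = s • W) (hZ : E Z = s • Z) (hc : W * Z = Z * W) : E (1 + W * Z) = 1 + W * Z := by
  rw [map_add, hE1, hEm, hW, hZ, smul_mul_smul_comm, hs, one_smul, ← hc]

include h𝔞c hEm hM in
/-- **Multiplying by an even integral element of `𝔞` preserves each eigen-lattice**: `a ∈ M i`, `u ∈ 𝔞`, `u ≤ 1`, `E u = u` ⇒ `a·u ∈ M i`.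
[cite: Serre1992LALG, Part II Ch. IV §9] -/
theorem mul_even_mem {i : ℕ} {a u : Matrix m m K} (ha : a ∈ M i) (hu𝔞 : u ∈ 𝔞) (hu1 : ValBound 1 u) (hEu : E u = u) : a * u ∈ M i := by
  obtain ⟨hab, ha𝔞, hEa⟩ := (hM i a).1 ha
  refine (hM i _).2 ⟨by simpa using hab.mul hu1, 𝔞.mul_mem ha𝔞 hu𝔞, ?_⟩
  rw [hEm, hEu, hEa, mul_smul_comm, h𝔞c a ha𝔞 u hu𝔞]

include h𝔞c h𝔞i hEm hE1 hs hM in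
/-- **The velocity sum stays in the eigen-lattice**: `W, Z ∈ M i ⇒ S(W, Z) = (W + Z)(1 + WZ)⁻¹ ∈ M i` (`α < 1`). [cite: Serre1992LALG, Part II Ch. IV §8–§9] -/
theorem velocity_add_mem (hα1 : α < 1) {i : ℕ} {W Z : Matrix m m K} (hW : W ∈ M i) (hZ : Z ∈ M i) : (W + Z) * (1 + W * Z)⁻¹ ∈ M i := by
  obtain ⟨hWb, hW𝔞, hEW⟩ := (hM i W).1 hW
  obtain ⟨hZb, hZ𝔞, hEZ⟩ := (hM i Z).1 hZ
  have hαi : α ^ (i + 1) < 1 := pow_lt_one₀ zero_le hα1 (Nat.succ_ne_zero i)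
  obtain ⟨hB, hBi1, -⟩ := isUnit_det_one_add_mul_of_valBound hWb hZb hαi hαi.le
  have hc : W * Z = Z * W := h𝔞c W hW𝔞 Z hZ𝔞
  have hB𝔞 : 1 + W * Z ∈ 𝔞 := 𝔞.add_mem 𝔞.one_mem (𝔞.mul_mem hW𝔞 hZ𝔞)
  refine mul_even_mem 𝔞 h𝔞c E hEm M hM ((M i).add_mem hW hZ) (h𝔞i _ hB𝔞 hB) hBi1 ?_
  rw [map_nonsing_inv_eq E hEm hE1 hB, map_one_add_mul_eq E hEm hE1 hs hEW hEZ hc]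

include h𝔞c h𝔞i hEm hE1 hs hM in
/-- **`ψ` preserves the eigen-lattice**: `W ∈ M i ⇒ ψ(W) = W(1 + W²)⁻¹ ∈ M i` (`α < 1`). [cite: Serre1992LALG, Part II Ch. IV §8–§9] -/
theorem psi_mem (hα1 : α < 1) {i : ℕ} {W : Matrix m m K} (hW : W ∈ M i) : W * (1 + W * W)⁻¹ ∈ M i := by
  obtain ⟨hWb, hW𝔞, hEW⟩ := (hM i W).1 hW
  have hαi : α ^ (i + 1) < 1 := pow_lt_one₀ zero_le hα1 (Nat.succ_ne_zero i)
  obtain ⟨hB, hBi1, -⟩ := isUnit_det_one_add_mul_of_valBound hWb hWb hαi hαi.le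
  have hB𝔞 : 1 + W * W ∈ 𝔞 := 𝔞.add_mem 𝔞.one_mem (𝔞.mul_mem hW𝔞 hW𝔞)
  refine mul_even_mem 𝔞 h𝔞c E hEm M hM hW (h𝔞i _ hB𝔞 hB) hBi1 ?_
  rw [map_nonsing_inv_eq E hEm hE1 hB, map_one_add_mul_eq E hEm hE1 hs hEW hEW rfl]

include h𝔞c h𝔞i hEm hE1 hs hM in
/-- The correction `a′ = a(1 − W²)(1 + W(a + a))⁻¹` of COSET IDENTITY (1) lies in `M i` when `W, a ∈ M i`. [cite: Serre1992LALG, Part II Ch. IV §9] -/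
theorem coset_corr_mem (hα1 : α < 1) {i : ℕ} {W a : Matrix m m K} (hW : W ∈ M i) (ha : a ∈ M i) :
    a * (1 - W * W) * (1 + W * (a + a))⁻¹ ∈ M i := by
  obtain ⟨hWb, hW𝔞, hEW⟩ := (hM i W).1 hW
  obtain ⟨haab, haa𝔞, hEaa⟩ := (hM i (a + a)).1 ((M i).add_mem ha ha)
  have hαi : α ^ (i + 1) < 1 := pow_lt_one₀ zero_le hα1 (Nat.succ_ne_zero i)
  obtain ⟨hB, hBi1, -⟩ := isUnit_det_one_add_mul_of_valBound hWb haab hαi hαi.le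
  have hB𝔞 : 1 + W * (a + a) ∈ 𝔞 := 𝔞.add_mem 𝔞.one_mem (𝔞.mul_mem hW𝔞 haa𝔞)
  have h1 : ValBound 1 (1 - W * W) := by
    refine valBound_one.sub ?_
    have h := hWb.mul hWb
    exact h.mono (by simpa using mul_le_mul' hαi.le hαi.le)
  have hE1W : E (1 - W * W) = 1 - W * W := by rw [map_sub, hE1, hEm, hEW, smul_mul_smul_comm, hs, one_smul]
  refine mul_even_mem 𝔞 h𝔞c E hEm M hM (mul_even_mem 𝔞 h𝔞c E hEm M hM ha (𝔞.sub_mem 𝔞.one_mem (𝔞.mul_mem hW𝔞 hW𝔞)) h1 hE1W)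
    (h𝔞i _ hB𝔞 hB) hBi1 ?_
  rw [map_nonsing_inv_eq E hEm hE1 hB, map_one_add_mul_eq E hEm hE1 hs hEW hEaa (h𝔞c W hW𝔞 _ haa𝔞)]

include h𝔞c h𝔞i hEm hE1 hs hM in
/-- The correction `a″ = a(1 − (W² + (a + a)W))⁻¹` of COSET IDENTITY (2) lies in `M i` when `W, a ∈ M i`. [cite: Serre1992LALG, Part II Ch. IV §9] -/
theorem coset_corr_mem' (hα1 : α < 1) {i : ℕ} {W a : Matrix m m K} (hW : W ∈ M i) (ha : a ∈ M i) :
    a * (1 - (W * W + (a + a) * W))⁻¹ ∈ M i := by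
  obtain ⟨hWb, hW𝔞, hEW⟩ := (hM i W).1 hW
  obtain ⟨haab, haa𝔞, hEaa⟩ := (hM i (a + a)).1 ((M i).add_mem ha ha)
  have hαi : α ^ (i + 1) < 1 := pow_lt_one₀ zero_le hα1 (Nat.succ_ne_zero i)
  have hsmall : ValBound (α ^ (i + 1)) (W * W + (a + a) * W) := by
    have h1 : ValBound (α ^ (i + 1) * α ^ (i + 1)) (W * W) := hWb.mul hWb
    have h2 : ValBound (α ^ (i + 1) * α ^ (i + 1)) ((a + a) * W) := haab.mul hWb
    exact (h1.add h2).mono (by simpa using mul_le_mul' le_rfl hαi.le)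
  obtain ⟨hD, hDi1, -⟩ := isUnit_det_one_sub_of_valBound hsmall hαi
  have hD𝔞 : 1 - (W * W + (a + a) * W) ∈ 𝔞 := 𝔞.sub_mem 𝔞.one_mem (𝔞.add_mem (𝔞.mul_mem hW𝔞 hW𝔞) (𝔞.mul_mem haa𝔞 hW𝔞))
  refine mul_even_mem 𝔞 h𝔞c E hEm M hM ha (h𝔞i _ hD𝔞 hD) hDi1 ?_
  rw [map_nonsing_inv_eq E hEm hE1 hD, map_sub, hE1, map_add, hEm, hEm, hEW, hEaa, smul_mul_smul_comm, smul_mul_smul_comm, hs, one_smul, one_smul,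
    h𝔞c W hW𝔞 _ haa𝔞]

end Eigen

end Summit.HodgeConjecture.HodgeConjecture.R90.S4
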